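import Literature.AlgebraicGeometry.Frobenioids.CircleOpensSubarcs
import Literature.AlgebraicGeometry.Frobenioids.ArchimedeanCircleGeometry
import Literature.AlgebraicGeometry.Frobenioids.AngularFrobenioidsRelative
import HarnessLib

/-!
# Frobenioids II, Theorem 3.6 (v) (a): open arcs of `S¹` have trivial stabilizer, and the scalar of
# a unit `u ∈ O^×(X)` of the archimedean Frobenioid `C` rotates the angular part of `A_X` onto itself

Mochizuki, *The geometry of Frobenioids II: poly-Frobenioids*, Kyushu J. Math. **62** (2008)
401–460, §3, Theorem 3.6 (v), author's kurims text p. 37 [cite: MochizukiFrdII2008, Thm 3.6 (v) p.37]: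
"(v) Let `A ∈ Ob(F)`. Then the group `O^×(A)` is trivial if and only if one of the following holds:
(a) `Λ = ℤ` and `A` is complex non-isotropic; (b) `Λ = ℚ` and `A` is real; (c) `Λ = ℝ`. …"

PROOF-ONLY companion (abc-iut cell, layer L1, seat abc-iut-L6-d7; PIECE 1 of abc-iut-L1-t9's
PIECES 2026-08-25T21:10:12Z, re-addressed by abc-iut-L1-lead (gen 2) 21:10:34Z). The statements of
Theorem 3.6 stay abc-iut-L1-t9's (`ArchimedeanBasicProperties.lean`); the categories are
abc-iut-L1-t6's Example 3.3 (`AngularFrobenioidsRelative.lean`: `C π = C₀ ×_{D₀} D` over any base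
`π : D → D₀`, structure `C.toElem π`). No new notion; nothing printed is strengthened; nothing here bears
on [IUTchIII] Cor 3.12.

**Contents.**
* `circle_stabilizer_trivial`, `arc_stabilizer_trivial` (the signature requested by abc-iut-L1-t9): a
  nonempty connected open PROPER subset `U ⊊ S¹` (Mathlib `Circle`, resp. abc-iut-L1-t4's
  `normOneSubgroup ℂ = O_ℂ^×`) satisfies `c · U = U ⇒ c = 1` — by abc-iut-L1-t7's arc calculus
  (`CircleOpensArcs`/`CircleOpensSubarcs`: `U = exp(i·(c, d))`, a rotation by `t` with the same image
  forces `t ∈ 2πℤ`), transported along `S¹ ≅ O_ℂ^×` (`exists_unitCircleEquiv`).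
* The scalar `c` of `u = ((id, 1, c), id) ∈ O^×(X)`, for ANY `X ∈ Ob(C)`: `|c| = 1`
  (`norm_scalar_eq_one`, testing `c · A_X ⊆ A_X` at a boundary point) and `c · B = B` for the angular
  part `B` of `A_X = B × (0, λ]` (`unitScalar_smul_dir`); hence `O^×(X) = {1}` when `X` is not naively
  isotropic (`unitsSubgroup_eq_bot_of_not_isNaivelyIsotropic`) — Thm 3.6 (v) (a).
* The involution `((id, 1, -1), id) ∈ O^×(X)` of a naively isotropic `X` (`negUnit`, `negUnit_ne_one`,
  `negUnit_mul_self`, `exists_torsion_ne_one`), used for the real and the torsion-free clauses in the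
  companion `ArchimedeanUnitStabilizersThm36v.lean`.
-/

namespace Literature.AlgebraicGeometry.Frobenioids

open CategoryTheory Set Topology
open scoped Pointwise

universe v u

namespace ArchFrd

namespace UnitStab

/-- A [nonempty] connected open PROPER subset of Mathlib's `Circle` has trivial stabilizer under
rotations: `w · A = A ⇒ w = 1` (an open arc `exp(i·(c, d))`, `d - c ≤ 2π`, translated by `t` is the arc
`exp(i·(t + c, t + d))`; if that is the same arc then `t ∈ 2πℤ`). The "arc length" argument behind
[FrdII] Thm 3.6 (v) (a) "`O^×(A)` is trivial for `Λ = ℤ` and `A` complex non-isotropic", p. 37.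
[cite: MochizukiFrdII2008, Thm 3.6 (v) p.37] -/
theorem circle_stabilizer_trivial {A : Set Circle} (hA : IsConnected A) (hAo : IsOpen A)
    (hne : A ≠ univ) (w : Circle) (hw : w • A = A) : w = 1 := by
  obtain ⟨p, hp⟩ : ∃ p, p ∉ A :=
    not_forall.mp fun h => hne (eq_univ_of_forall h)
  have hp' : Circle.exp (CircleOpens.liftIco 0 p) ∉ A := by rwa [CircleOpens.exp_liftIco]
  obtain ⟨c, d, hc0, hcd, hd, rfl⟩ := CircleOpens.exists_eq_exp_image_Ioo_of_notMem hA hAo hp'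
  set t := CircleOpens.liftIco 0 w with ht
  have hwt : Circle.exp t = w := CircleOpens.exp_liftIco 0 w
  have htrans : w • (Circle.exp '' Ioo c d) = Circle.exp '' Ioo (t + c) (t + d) := by
    rw [← hwt, CircleOpens.exp_smul_exp_image, image_const_add_Ioo]
  have hsub : Circle.exp '' Ioo (t + c) (t + d) ⊆ Circle.exp '' Ioo c d := by
    rw [← htrans, hw]
  obtain ⟨k, hk⟩ :=
    CircleOpens.exists_int_shift_Ioo_subset (by linarith) (by linarith) hsub
  have hk' := (Ioo_subset_Ioo_iff (by linarith : t + c + k * (2 * Real.pi) < t + d + k * (2 * Real.pi))).mp hk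
  have ht0 : t = (-k : ℤ) * (2 * Real.pi) := by push_cast; linarith [hk'.1, hk'.2]
  rw [← hwt, Circle.exp_eq_one]
  exact ⟨-k, ht0⟩

/-- **[FrdII] Thm 3.6 (v) (a), the geometric input** (p. 37): a nonempty connected open proper subset
`U ⊊ O_ℂ^× = S¹` (abc-iut-L1-t4's `normOneSubgroup ℂ`) has trivial stabilizer under the rotation
action of `O_ℂ^×` on itself: `c · U = U ⇒ c = 1`. Transported from `circle_stabilizer_trivial` along the
topological-group isomorphism `S¹ ≅ O_ℂ^×` (`exists_unitCircleEquiv`). This is EXACTLY the signature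
`ArchFrd.UnitStab.arc_stabilizer_trivial` requested by abc-iut-L1-t9 (PIECES 2026-08-25T21:10:12Z).
[cite: MochizukiFrdII2008, Thm 3.6 (v) p.37] -/
theorem arc_stabilizer_trivial :
    ∀ (U : Set (normOneSubgroup ℂ)), IsOpen U → IsConnected U → U.Nonempty → U ≠ Set.univ →
      ∀ c : normOneSubgroup ℂ, c • U = U → c = 1 := by
  intro U hUo hUc _ hUne c hc
  obtain ⟨e, h, heh, -⟩ := exists_unitCircleEquiv
  have hpre : h ⁻¹' U = h.symm '' U := by rw [h.image_symm]
  have hAo : IsOpen (h ⁻¹' U) := hUo.preimage h.continuous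
  have hAc : IsConnected (h ⁻¹' U) := by
    rw [hpre]
    exact hUc.image h.symm h.symm.continuous.continuousOn
  have hAne : h ⁻¹' U ≠ univ := by
    intro H
    apply hUne
    rw [← h.image_preimage U, H, image_univ, h.range_coe]
  have hsm : e.symm c • (h ⁻¹' U) = h ⁻¹' U := by
    ext z
    rw [mem_smul_set_iff_inv_smul_mem, smul_eq_mul, mem_preimage, mem_preimage, heh, heh, map_mul,
      map_inv, e.apply_symm_apply]
    constructor
    · intro hz
      have := smul_mem_smul_set (a := c) hz
      rwa [smul_eq_mul, mul_inv_cancel_left, hc] at this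
    · intro hz
      rw [← hc] at hz
      obtain ⟨y, hy, hyz⟩ := hz
      rw [← hyz]
      change c⁻¹ * (c * y) ∈ U
      rwa [inv_mul_cancel_left]
  have h1 := circle_stabilizer_trivial hAc hAo hAne (e.symm c) hsm
  rw [← e.apply_symm_apply c, h1, map_one]

/-! ### The scalar of a unit: `O^×(X) ∋ u = ((id, 1, c), id)` with `c · A_X = A_X` -/

section Units

variable {D : Type u} [Category.{v} D] (π : D ⥤ D0)

/-- The `C₀`-component of an element of `O^×(X)` lies over the identity of `D₀`.
[cite: MochizukiFrdII2008, Thm 3.6 (v) p.37] -/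
theorem base_fst_eq_id (X : C π) (u : Aut X)
    (hu : u ∈ PreFrobenioid.unitsSubgroup (C.toElem π) X) : C0.Base u.hom.fst = 𝟙 X.fst.base := by
  obtain ⟨hb, -⟩ := hu
  have hsnd : u.hom.snd = 𝟙 X.snd := hb
  have hw := u.hom.w
  rw [hsnd, CategoryTheory.Functor.map_id, Category.comp_id] at hw
  exact (cancel_mono X.iso.hom).mp (hw.trans (Category.id_comp _).symm)

/-- The scalars of `u` and `u⁻¹` multiply to `1` for `u ∈ O^×(X)`. [cite: MochizukiFrdII2008, Thm 3.6 (v) p.37] -/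
theorem scalar_mul_scalar_inv (X : C π) (u : Aut X)
    (hu : u ∈ PreFrobenioid.unitsSubgroup (C.toElem π) X) :
    C0.scalar u.hom.fst * C0.scalar u.inv.fst = 1 := by
  have hbase' : C0.Base u.inv.fst = 𝟙 X.fst.base := base_fst_eq_id π X u⁻¹ (inv_mem hu)
  have hdeg : C0.degFr u.hom.fst = 1 := hu.2
  have h := congrArg (fun f => C0.scalar (CFP.Hom.fst f)) u.inv_hom_id
  change C0.scalar (u.inv.fst ≫ u.hom.fst) = C0.scalar (𝟙 X.fst) at h
  rw [C0.scalar_comp', C0.scalar_id', hbase', hdeg, PNat.one_coe, pow_one] at h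
  change D0.Hom.act (𝟙 X.fst.base) (C0.scalar u.hom.fst) * C0.scalar u.inv.fst = 1 at h
  unfold D0.Hom.act at h
  rwa [D0.twists_id, D0.galAct_false] at h

/-- The scalar of `u⁻¹` is the inverse of the scalar of `u`. [cite: MochizukiFrdII2008, Thm 3.6 (v) p.37] -/
theorem scalar_inv_eq (X : C π) (u : Aut X) (hu : u ∈ PreFrobenioid.unitsSubgroup (C.toElem π) X) :
    C0.scalar u.inv.fst = (C0.scalar u.hom.fst)⁻¹ :=
  eq_inv_of_mul_eq_one_right (scalar_mul_scalar_inv π X u hu)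

/-- `c · A_X ⊆ A_X` for the scalar `c` of `u ∈ O^×(X)` (the condition (c) of Ex. 3.3 (i) for a
base-identity linear endomorphism). [cite: MochizukiFrdII2008, Ex 3.3 (i) p.27] -/
theorem scalar_mul_mem_carrier (X : C π) (u : Aut X)
    (hu : u ∈ PreFrobenioid.unitsSubgroup (C.toElem π) X) {x : ℂˣ}
    (hx : x ∈ X.fst.region.carrier) : C0.scalar u.hom.fst * x ∈ X.fst.region.carrier := by
  have hdeg : C0.degFr u.hom.fst = 1 := hu.2
  have h2 := (C0.Hom.mapsTo u.hom.fst) (Set.smul_mem_smul_set (a := C0.scalar u.hom.fst)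
    (Set.pow_mem_pow hx (n := (C0.degFr u.hom.fst : ℕ))))
  rw [hdeg, PNat.one_coe, pow_one] at h2
  change _ ∈ C0.pullRegion X.fst (C0.Base u.hom.fst) at h2
  rw [base_fst_eq_id π X u hu, C0.pullRegion_id] at h2
  exact h2

/-- The point `z · λ` of the boundary `∂A` above a direction `z ∈ B` (`A = B × (0, λ]`).
[cite: MochizukiFrdII2008, Def 3.1 (iii) p.24] -/
theorem dirPoint_spec (A : AngularRegion ℂ) (z : normOneSubgroup ℂ) :
    unitPart ℂ ((z : ℂˣ) * ofPosReal ℂ A.tip) = z ∧ absHom ℂ ((z : ℂˣ) * ofPosReal ℂ A.tip) = A.tip := by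
  have e := Prod.ext_iff.mp ((unitDecomposition ℂ).symm_apply_apply (z, A.tip))
  exact ⟨e.1, e.2⟩

/-- `z · λ ∈ A` for `z ∈ B`. [cite: MochizukiFrdII2008, Def 3.1 (iii) p.24] -/
theorem dirPoint_mem (A : AngularRegion ℂ) {z : normOneSubgroup ℂ} (hz : z ∈ A.dir) :
    (z : ℂˣ) * ofPosReal ℂ A.tip ∈ A.carrier := by
  obtain ⟨h1, h2⟩ := dirPoint_spec A z
  exact ⟨by rw [h1]; exact hz, by rw [h2]⟩

/-- The unit part is multiplicative (polar decomposition is a group isomorphism).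
[cite: MochizukiFrdII2008, Def 3.1 (ii) p.23] -/
theorem unitPart_mul (a b : ℂˣ) : unitPart ℂ (a * b) = unitPart ℂ a * unitPart ℂ b :=
  congrArg Prod.fst (map_mul (unitDecomposition ℂ).symm a b)

/-- A unit of norm one is its own unit part. [cite: MochizukiFrdII2008, Def 3.1 (ii) p.23] -/
theorem unitPart_eq_of_norm_eq_one (c : ℂˣ) (hc : ‖(c : ℂ)‖ = 1) :
    unitPart ℂ c = ⟨c, (mem_normOneSubgroup_iff ℂ c).mpr hc⟩ := by
  have habs : absHom ℂ c = 1 := Subtype.ext (by rw [coe_absHom, hc]; rfl)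
  apply Subtype.ext
  change c * (ofPosReal ℂ (absHom ℂ c))⁻¹ = c
  rw [habs, map_one, inv_one, mul_one]

/-- For ANY object `X` of `C` (isotropic or not), the scalar `c` of `u ∈ O^×(X)` has `|c| ≤ 1`: test
`c · A_X ⊆ A_X` at a boundary point `z · λ`, `z ∈ B` (`B ≠ ∅`). [cite: MochizukiFrdII2008, Thm 3.6 (v) p.37] -/
theorem norm_scalar_le_one (X : C π) (u : Aut X) (hu : u ∈ PreFrobenioid.unitsSubgroup (C.toElem π) X) :
    ‖((C0.scalar u.hom.fst : ℂˣ) : ℂ)‖ ≤ 1 := by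
  obtain ⟨z, hz⟩ := (AngularRegion.isConnected_dir X.fst.region).nonempty
  have hmem := scalar_mul_mem_carrier π X u hu (dirPoint_mem X.fst.region hz)
  have h2 : absHom ℂ (C0.scalar u.hom.fst * ((z : ℂˣ) * ofPosReal ℂ X.fst.region.tip)) ≤
      X.fst.region.tip := hmem.2
  rw [map_mul, (dirPoint_spec X.fst.region z).2, ← Subtype.coe_le_coe, Positive.val_mul,
    coe_absHom] at h2
  have ht : (0 : ℝ) < X.fst.region.tip := X.fst.region.tip.2
  calc ‖((C0.scalar u.hom.fst : ℂˣ) : ℂ)‖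
      = ‖((C0.scalar u.hom.fst : ℂˣ) : ℂ)‖ * X.fst.region.tip / X.fst.region.tip := by
        rw [mul_div_cancel_right₀ _ ht.ne']
    _ ≤ X.fst.region.tip / X.fst.region.tip := by gcongr
    _ = 1 := div_self ht.ne'

/-- … hence `|c| = 1` (apply the bound to `u` and `u⁻¹`). [cite: MochizukiFrdII2008, Thm 3.6 (v) p.37] -/
theorem norm_scalar_eq_one (X : C π) (u : Aut X) (hu : u ∈ PreFrobenioid.unitsSubgroup (C.toElem π) X) :
    ‖((C0.scalar u.hom.fst : ℂˣ) : ℂ)‖ = 1 := by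
  have h1 := norm_scalar_le_one π X u hu
  have h2 := norm_scalar_le_one π X u⁻¹ (inv_mem hu)
  change ‖((C0.scalar u.inv.fst : ℂˣ) : ℂ)‖ ≤ 1 at h2
  rw [scalar_inv_eq π X u hu, Units.val_inv_eq_inv_val, norm_inv] at h2
  have hpos : 0 < ‖((C0.scalar u.hom.fst : ℂˣ) : ℂ)‖ := norm_pos_iff.mpr (C0.scalar u.hom.fst).ne_zero
  exact le_antisymm h1 ((inv_le_one₀ hpos).mp h2)

/-- The scalar of `u ∈ O^×(X)` as an element of `O_ℂ^× = S¹`. [cite: MochizukiFrdII2008, Thm 3.6 (v) p.37] -/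
noncomputable def unitScalar (X : C π) (u : Aut X)
    (hu : u ∈ PreFrobenioid.unitsSubgroup (C.toElem π) X) : normOneSubgroup ℂ :=
  ⟨C0.scalar u.hom.fst, (mem_normOneSubgroup_iff ℂ _).mpr (norm_scalar_eq_one π X u hu)⟩

/-- The scalar of `u ∈ O^×(X)` rotates the angular part `B` of `A_X` INTO itself.
[cite: MochizukiFrdII2008, Thm 3.6 (v) p.37] -/
theorem unitScalar_smul_dir_subset (X : C π) (u : Aut X)
    (hu : u ∈ PreFrobenioid.unitsSubgroup (C.toElem π) X) :
    unitScalar π X u hu • X.fst.region.dir ⊆ X.fst.region.dir := by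
  rintro _ ⟨z, hz, rfl⟩
  have hmem := scalar_mul_mem_carrier π X u hu (dirPoint_mem X.fst.region hz)
  have h1 := hmem.1
  rw [unitPart_mul, (dirPoint_spec X.fst.region z).1,
    unitPart_eq_of_norm_eq_one _ (norm_scalar_eq_one π X u hu)] at h1
  exact h1

/-- `unitScalar (u⁻¹) = (unitScalar u)⁻¹`. [cite: MochizukiFrdII2008, Thm 3.6 (v) p.37] -/
theorem unitScalar_inv (X : C π) (u : Aut X) (hu : u ∈ PreFrobenioid.unitsSubgroup (C.toElem π) X) :
    unitScalar π X u⁻¹ (inv_mem hu) = (unitScalar π X u hu)⁻¹ := by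
  apply Subtype.ext
  change C0.scalar u.inv.fst = (C0.scalar u.hom.fst)⁻¹
  exact scalar_inv_eq π X u hu

/-- The scalar of `u ∈ O^×(X)` rotates the angular part `B` of `A_X` ONTO itself: `c · B = B`.
[cite: MochizukiFrdII2008, Thm 3.6 (v) p.37] -/
theorem unitScalar_smul_dir (X : C π) (u : Aut X)
    (hu : u ∈ PreFrobenioid.unitsSubgroup (C.toElem π) X) :
    unitScalar π X u hu • X.fst.region.dir = X.fst.region.dir := by
  refine (unitScalar_smul_dir_subset π X u hu).antisymm fun z hz => ?_
  have h := unitScalar_smul_dir_subset π X u⁻¹ (inv_mem hu)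
  rw [unitScalar_inv π X u hu] at h
  have hz' : (unitScalar π X u hu)⁻¹ • z ∈ X.fst.region.dir := h (smul_mem_smul_set hz)
  exact ⟨_, hz', by simp only [smul_eq_mul, mul_inv_cancel_left]⟩

/-- An element of `O^×(X)` is determined by its scalar. [cite: MochizukiFrdII2008, Thm 3.6 (v) p.37] -/
theorem eq_of_scalar_eq (X : C π) (u u' : Aut X) (hu : u ∈ PreFrobenioid.unitsSubgroup (C.toElem π) X)
    (hu' : u' ∈ PreFrobenioid.unitsSubgroup (C.toElem π) X)
    (h : C0.scalar u.hom.fst = C0.scalar u'.hom.fst) : u = u' := by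
  apply Iso.ext
  refine CFP.hom_ext (C0.hom_ext ?_ ?_ h) ?_
  · rw [base_fst_eq_id π X u hu, base_fst_eq_id π X u' hu']
  · have h1 : C0.degFr u.hom.fst = 1 := hu.2
    have h2 : C0.degFr u'.hom.fst = 1 := hu'.2
    rw [h1, h2]
  · have h1 : u.hom.snd = 𝟙 X.snd := hu.1
    have h2 : u'.hom.snd = 𝟙 X.snd := hu'.1
    rw [h1, h2]

/-- **[FrdII] Thm 3.6 (v) (a), the mechanism**: if `X ∈ Ob(C)` is NOT naively isotropic (its
angular part `B ⊊ S¹` is a proper open arc), then `O^×(X) = {1}` — the scalar of a unit rotates `B`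
onto itself, so it is `1` by `arc_stabilizer_trivial`. [cite: MochizukiFrdII2008, Thm 3.6 (v) p.37] -/
theorem eq_one_of_not_isNaivelyIsotropic (X : C π) (hX : ¬ X.fst.IsNaivelyIsotropic) (u : Aut X)
    (hu : u ∈ PreFrobenioid.unitsSubgroup (C.toElem π) X) : u = 1 := by
  have hdir := arc_stabilizer_trivial X.fst.region.dir X.fst.region.isOpen_dir
    (AngularRegion.isConnected_dir X.fst.region) (AngularRegion.isConnected_dir X.fst.region).nonempty
    hX (unitScalar π X u hu) (unitScalar_smul_dir π X u hu)
  have hc : C0.scalar u.hom.fst = 1 := by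
    have := congrArg (fun w : normOneSubgroup ℂ => (w : ℂˣ)) hdir
    exact this
  exact eq_of_scalar_eq π X u 1 hu (one_mem _) (by rw [hc]; rfl)

/-- `O^×(X) = {1}` for `X` not naively isotropic. [cite: MochizukiFrdII2008, Thm 3.6 (v) p.37] -/
theorem unitsSubgroup_eq_bot_of_not_isNaivelyIsotropic (X : C π) (hX : ¬ X.fst.IsNaivelyIsotropic) :
    PreFrobenioid.unitsSubgroup (C.toElem π) X = ⊥ :=
  (Subgroup.eq_bot_iff_forall _).mpr fun u hu => eq_one_of_not_isNaivelyIsotropic π X hX u hu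

/-! ### The unit `((id, 1, -1), id)` of a naively isotropic object -/

/-- `|-1| = 1` in `ℝ_{>0}`. [cite: MochizukiFrdII2008, Def 3.1 (ii) p.23] -/
theorem absHom_neg_one : absHom ℂ (-1) = 1 :=
  Subtype.ext (by rw [coe_absHom, Units.val_neg, Units.val_one, norm_neg, norm_one]; rfl)

/-- `-1 ∈ K^×` for both `K = ℝ, ℂ`. [cite: MochizukiFrdII2008, Def 3.1 (i) p.23] -/
theorem neg_one_mem_scalars (K : D0) : (-1 : ℂˣ) ∈ D0.scalars K := by
  cases K with
  | real => rw [D0.mem_scalars_real_iff]; simp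
  | complex => rw [D0.scalars_complex]; exact Subgroup.mem_top _

/-- The endomorphism `(id, 1, -1)` of a naively isotropic object of `C₀` (`-A_K = A_K` for an
isotropic region). [cite: MochizukiFrdII2008, Ex 3.3 (i) p.27] -/
noncomputable def C0.negEnd (A : C0) (hA : A.IsNaivelyIsotropic) : A ⟶ A where
  base := 𝟙 A.base
  degFr := 1
  scalar := -1
  scalar_mem := neg_one_mem_scalars A.base
  mapsTo := by
    rw [PNat.one_coe, pow_one, C0.pullRegion_id]
    rintro _ ⟨x, hx, rfl⟩
    rw [C0.mem_carrier_of_isIsotropic hA] at hx ⊢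
    change absHom ℂ (-1 * x) ≤ A.region.tip
    rwa [map_mul, absHom_neg_one, one_mul]

/-- `(id, 1, -1)² = id`. [cite: MochizukiFrdII2008, Ex 3.3 (i) p.27] -/
theorem C0.negEnd_comp_negEnd (A : C0) (hA : A.IsNaivelyIsotropic) :
    C0.negEnd A hA ≫ C0.negEnd A hA = 𝟙 A := by
  refine C0.hom_ext (Category.comp_id _) (mul_one _) ?_
  rw [C0.scalar_comp', C0.scalar_id']
  change D0.Hom.act (𝟙 A.base) (-1) * (-1) ^ ((1 : ℕ+) : ℕ) = 1
  unfold D0.Hom.act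
  rw [D0.twists_id, D0.galAct_false, PNat.one_coe, pow_one, neg_one_mul, neg_neg]

/-- The automorphism `(id, 1, -1)` of a naively isotropic object of `C₀`. [cite: MochizukiFrdII2008, Ex 3.3 (i) p.27] -/
noncomputable def C0.negAut (A : C0) (hA : A.IsNaivelyIsotropic) : A ≅ A where
  hom := C0.negEnd A hA
  inv := C0.negEnd A hA
  hom_inv_id := C0.negEnd_comp_negEnd A hA
  inv_hom_id := C0.negEnd_comp_negEnd A hA

/-- The automorphism `((id, 1, -1), id)` of an object of `C` with naively isotropic `C₀`-component.
[cite: MochizukiFrdII2008, Thm 3.6 (v) p.37] -/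
noncomputable def negAutOver (X : C π) (hX : X.fst.IsNaivelyIsotropic) : X ≅ X :=
  CFP.isoMk (C0.negAut X.fst hX) (Iso.refl X.snd) (by
    change 𝟙 _ ≫ X.iso.hom = X.iso.hom ≫ π.map (𝟙 X.snd)
    rw [CategoryTheory.Functor.map_id, Category.id_comp, Category.comp_id])

/-- `((id, 1, -1), id) ∈ O^×(X)`. [cite: MochizukiFrdII2008, Thm 3.6 (v) p.37] -/
theorem negAutOver_mem (X : C π) (hX : X.fst.IsNaivelyIsotropic) :
    negAutOver π X hX ∈ PreFrobenioid.unitsSubgroup (C.toElem π) X :=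
  ⟨rfl, rfl⟩

/-- Its scalar is `-1`. [cite: MochizukiFrdII2008, Thm 3.6 (v) p.37] -/
theorem scalar_negAutOver (X : C π) (hX : X.fst.IsNaivelyIsotropic) :
    C0.scalar (negAutOver π X hX).hom.fst = -1 := rfl

/-- `((id, 1, -1), id)` as an element of the group `O^×(X)`. [cite: MochizukiFrdII2008, Thm 3.6 (v) p.37] -/
noncomputable def negUnit (X : C π) (hX : X.fst.IsNaivelyIsotropic) :
    PreFrobenioid.unitsSubgroup (C.toElem π) X :=
  ⟨negAutOver π X hX, negAutOver_mem π X hX⟩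

/-- `((id, 1, -1), id) ≠ id` (its scalar is `-1 ≠ 1`). [cite: MochizukiFrdII2008, Thm 3.6 (v) p.37] -/
theorem negUnit_ne_one (X : C π) (hX : X.fst.IsNaivelyIsotropic) : negUnit π X hX ≠ 1 := by
  intro h
  have h1 := congrArg
    (fun w : PreFrobenioid.unitsSubgroup (C.toElem π) X => ((C0.scalar (w : Aut X).hom.fst : ℂˣ) : ℂ)) h
  change (((-1 : ℂˣ) : ℂˣ) : ℂ) = (((C0.scalar (𝟙 X.fst)) : ℂˣ) : ℂ) at h1
  rw [C0.scalar_id', Units.val_neg, Units.val_one] at h1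
  norm_num at h1

/-- `((id, 1, -1), id)² = id`. [cite: MochizukiFrdII2008, Thm 3.6 (v) p.37] -/
theorem negUnit_mul_self (X : C π) (hX : X.fst.IsNaivelyIsotropic) :
    negUnit π X hX * negUnit π X hX = 1 := by
  apply Subtype.ext
  apply Iso.ext
  change (negAutOver π X hX).hom ≫ (negAutOver π X hX).hom = 𝟙 X
  refine CFP.hom_ext ?_ ?_
  · rw [CFP.comp_fst, CFP.id_fst]
    exact C0.negEnd_comp_negEnd X.fst hX
  · rw [CFP.comp_snd, CFP.id_snd]
    exact Category.comp_id _

/-- So `O^×(X)` has a NONTRIVIAL TORSION element whenever `X` is naively isotropic (real, or complex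
isotropic). [cite: MochizukiFrdII2008, Thm 3.6 (v) p.37] -/
theorem exists_torsion_ne_one (X : C π) (hX : X.fst.IsNaivelyIsotropic) :
    ∃ u : PreFrobenioid.unitsSubgroup (C.toElem π) X, IsOfFinOrder u ∧ u ≠ 1 := by
  refine ⟨negUnit π X hX, ?_, negUnit_ne_one π X hX⟩
  rw [isOfFinOrder_iff_pow_eq_one]
  exact ⟨2, two_pos, by rw [pow_two]; exact negUnit_mul_self π X hX⟩

/-- An object of `D₀` receiving an arrow from a real object is real. [cite: MochizukiFrdII2008, §3 p.23] -/
theorem D0.isReal_of_hom_real {K L : D0} (f : K ⟶ L) (hK : K.IsReal) : L.IsReal := by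
  unfold D0.IsReal at *
  subst hK
  cases L
  · rfl
  · exact (D0.isEmpty_hom_real_complex.false f).elim

/-- A real scalar of norm one is `±1`. [cite: MochizukiFrdII2008, Def 3.1 (i) p.23] -/
theorem eq_one_or_eq_neg_one_of_mem_scalars_real {c : ℂˣ} (hc : c ∈ D0.scalars .real)
    (hn : ‖(c : ℂ)‖ = 1) : c = 1 ∨ c = -1 := by
  rw [D0.mem_scalars_real_iff] at hc
  have hre : ((c : ℂ).re : ℂ) = (c : ℂ) := Complex.ext rfl (by rw [Complex.ofReal_im, hc])
  rw [← hre, Complex.norm_real, Real.norm_eq_abs, abs_eq zero_le_one] at hn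
  rcases hn with h | h
  · left
    exact Units.ext (by rw [← hre, h, Complex.ofReal_one, Units.val_one])
  · right
    exact Units.ext (by rw [← hre, h, Complex.ofReal_neg, Complex.ofReal_one, Units.val_neg,
      Units.val_one])

end Units

end UnitStab

end ArchFrd

end Literature.AlgebraicGeometry.Frobenioids
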